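import Mathlib
import HarnessLib
import Summits.HubbardSuperconductivity.HubbardSuperconductivity.Theorems.KLProgrammeKLRegimeVolumeLimitV11HSupOfAtomsBW
import Summits.HubbardSuperconductivity.HubbardSuperconductivity.Theorems.KLProgrammeKLRegimeVolumeLimitV11TowerDataWOfSuppliersReg

/-!
# [«(VL)-SRC-WINDOW» SW twin (k3c4-p1 g16, filed by g17 under the pen's (R235) «KEY = WINDOW»): atoms HE1 ⊕ Hmis ⊕ HB1W ⊕ Hcov ⊕ producer ⇒ `∃ t, Nonempty (TowerDataTSW β U μ t)`]
# Route `KLProgramme` — crux K3, VL child `KLRegimeVolumeLimitV17F2` (stmt-HubbardSuperconductivity-20440), skeleton «cauchy» v11: THE `hSup` DISCHARGER,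
# part 8 — `stub_vl_towerData` UNDER `R.WF2` FROM THE FOUR ATOMS `Hcov / HE1 / Hmis / HB1W` AND THE PRODUCER TEXT (seat hubbard-kl-k3c4-p1 g16; `--supports` 20440)

Twin of `…V11TowerDataOfAtoms.stub_vl_towerData_WF2_of_atoms` over `…V11HSupOfAtomsB.hSupRegBody_of_atomsBW` (located «BASE-SRC-ROWS»: the base (H6) is the
atom `HB1W` itself; `Hbase`/`Hgrid` gone).  **`stub_vl_towerData_WF2_of_atomsB`** — the four atoms + the producer text (`stub_vl_srcProfiles`) ⇒ the conclusion
of `stub_vl_towerData` (v11) for every `(G, P, Q, R)` with `R.WF2` (located «VL-R-WF2»).  With `…V11HcovOfDoors.hcov_of_doors_and_scaleZero` and p3 g17's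
scale-0 doors, `Hcov` is a theorem; the VL data stub is thus CLOSED MODULO `HE1` (E1: units + alive read-out), `Hmis` (frame-mismatch rates), `HB1W` (the base
two-volume defect at scale 0) and the binder.

Proofs only; no definition.  Honest framing: plumbing; nothing here asserts any atom, the producer text, the stub, K3, VL or superconductivity.
[cite: BenfattoGiulianiMastropietro2006, §2.7-§2.9 and §3]
-/

noncomputable section

namespace Summit.HubbardSuperconductivity.HubbardSuperconductivity.Theorems.TwoVolumeSource

set_option linter.dupNamespace false -- summit = problem name (single-conjunct summit), D-0017

open Finset Filter Topology Literature.MathematicalPhysics.QuantumLattice GrassmannAlgebra Literature.Probability.LatticeModels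
  Literature.Probability.LatticeModels.BattleFederbush
open Summit.HubbardSuperconductivity.HubbardSuperconductivity.Theorems.KLRegimeSplit
open Summit.HubbardSuperconductivity.HubbardSuperconductivity.Theorems.KLProgrammeLegKernels
open Summit.HubbardSuperconductivity.HubbardSuperconductivity.Theorems.TwoPointAssembly
open Summit.HubbardSuperconductivity.HubbardSuperconductivity.Theorems.EngineV8
open Summit.HubbardSuperconductivity.HubbardSuperconductivity.Theorems.TwoVolumeDefect
open Summit.HubbardSuperconductivity.HubbardSuperconductivity.Theorems.TorusFourierL2

/-! ## The VL data stub under `R.WF2` from the five atoms and the producer text -/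

/-- **`stub_vl_towerData` (v11) UNDER `R.WF2`, FROM THE FIVE ATOMS AND THE PRODUCER TEXT** (`stub_vl_srcProfiles`): the threading of
`…V11TowerDataOfSuppliersReg.stub_vl_towerDataW_of_suppliers_reg_pos` (c₅/U₀ := min of the producer's, the `ε`-doors' and the atoms'; `A ↦ A⁺`) over
`hSupRegBody_of_atoms`.  The only difference from the registered stub text is the binder `R.WF2` (located «VL-R-WF2»).
[folklore: quantifier threading; cite: BenfattoGiulianiMastropietro2006, §2.7-§2.9 and §3] -/
theorem stub_vl_towerDataW_WF2_of_atomsB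
    (Hcov : ∀ (G : GeoConsts) (P : SplitConsts) (Q : EngConsts) (R : RenConsts), G.WF → P.WF → Q.WF → R.WF2 →
      ∃ k₁ a₁ s₁ e₁ w₁ ρ : ℝ, 0 < k₁ ∧ 0 < a₁ ∧ 0 ≤ s₁ ∧ 0 ≤ e₁ ∧ 1 ≤ w₁ ∧ 0 < ρ ∧
        ∃ c₇ : ℝ, 0 < c₇ ∧ ∀ c : ℝ, 0 < c → c ≤ c₇ → ∃ U₇ : ℝ, 0 < U₇ ∧
          ∀ μ ∈ klWindowC, ∀ U : ℝ, 0 < U → U ≤ U₇ → ∀ β : ℝ, klBetaMin ≤ β → β ≤ Real.exp (c / U ^ 2) →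
            ∀ (K : TrigPolyC4v) (Lstar : ℕ) (Mstar : ℕ → ℕ), TowerP klPredsV17F2 G P Q R β U μ K Lstar Mstar →
            ∀ Λ : ℝ, 0 ≤ Λ → Λ ≤ klScale klE0 (nScales β + 1) → Λ * (4 : ℝ) ^ (nScales β + 1) ≤ ρ →
            ∃ L₂ : ℕ, ∃ M₂ : ℕ → ℕ → ℕ, ∀ (L b M : ℕ) [NeZero L] [NeZero (b * L)] [NeZero M], L₂ ≤ L → M₂ L b ≤ M →
              (∀ j, j < nScales β → ScaleCovData (klStepCov L M β μ (klFlowFrameU L M β U μ (nScales β + 1)) j) Λ (Real.sqrt (k₁ ^ 2 * ((8 : ℝ) ^ j)⁻¹))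
                (a₁ * (4 : ℝ) ^ j / imagTimeWeight β M) s₁) ∧
              (∀ j, j < nScales β → ScaleCovData (klStepCov (b * L) M β μ (klFlowFrameU (b * L) M β U μ (nScales β + 1)) j) Λ (Real.sqrt (k₁ ^ 2 * ((8 : ℝ) ^ j)⁻¹))
                (a₁ * (4 : ℝ) ^ j / imagTimeWeight β M) s₁) ∧
              (∀ j, j < nScales β → ScaleCovData (klStepCov (b * L) M β μ (klFlowFrameU L M β U μ (nScales β + 1)) j) Λ (Real.sqrt (k₁ ^ 2 * ((8 : ℝ) ^ j)⁻¹))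
                (a₁ * (4 : ℝ) ^ j / imagTimeWeight β M) s₁) ∧
              (∀ j, j < nScales β → ScaleCovSecData (klStepCov (b * L) M β μ (klFlowFrameU L M β U μ (nScales β + 1)) j) Λ e₁) ∧
              (∀ j, j ≤ nScales β → TransferWtData (klTowerTransfer (b * L) M β μ (klFlowFrameU L M β U μ (nScales β + 1)) j)
                (klBlockEquivD L b M j) (klBlockEquivD L b M (j - 1)) Λ w₁))
    (HE1 : ∀ (G : GeoConsts) (P : SplitConsts) (Q : EngConsts) (R : RenConsts), G.WF → P.WF → Q.WF → R.WF2 →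
      ∃ C₀ : ℝ, 0 ≤ C₀ ∧
        ∃ c₇ : ℝ, 0 < c₇ ∧ ∀ c : ℝ, 0 < c → c ≤ c₇ → ∃ U₇ : ℝ, 0 < U₇ ∧
          ∀ μ ∈ klWindowC, ∀ U : ℝ, 0 < U → U ≤ U₇ → ∀ β : ℝ, klBetaMin ≤ β → β ≤ Real.exp (c / U ^ 2) →
            ∀ (K : TrigPolyC4v) (Lstar : ℕ) (Mstar : ℕ → ℕ), TowerP klPredsV17F2 G P Q R β U μ K Lstar Mstar →
            ∃ S₀ : ℕ → ℕ → ℝ, (∀ j m, 0 ≤ S₀ j m) ∧ (∀ j, j ≤ nScales β → ∀ m, 1 ≤ m → S₀ j (2 * m) ≤ C₀ * klWtBudget P Q U (j + 1) (2 * m)) ∧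
            ∃ L₂ : ℕ, ∃ M₂ : ℕ → ℕ, ∀ (L M : ℕ) [NeZero L] [NeZero M], L₂ ≤ L → M₂ L ≤ M →
              (∀ k, k ≤ nScales β → hubbardEffPartitionFnCT L M β U μ 0 (klFlowFrameU L M β U μ (nScales β + 1)) (klScale klE0 (k + 1)) ≠ 0) ∧
              (∀ j, j ≤ nScales β → ∀ (m : ℕ) (q : Fin m) (w : SpaceTimeIdx L M × SectorLeg (sectorCount j)),
                klWtPinnedSumAt L M β μ (klFlowFrameU L M β U μ (nScales β + 1)) j j m (klEffectiveAction L M β U μ (klFlowFrameU L M β U μ (nScales β + 1)) klE0 (j + 1)) q w ≤ S₀ j m))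
    (Hmis : ∀ (G : GeoConsts) (P : SplitConsts) (Q : EngConsts) (R : RenConsts), G.WF → P.WF → Q.WF → R.WF2 →
        ∃ c₇ : ℝ, 0 < c₇ ∧ ∀ c : ℝ, 0 < c → c ≤ c₇ → ∃ U₇ : ℝ, 0 < U₇ ∧
          ∀ μ ∈ klWindowC, ∀ U : ℝ, 0 < U → U ≤ U₇ → ∀ β : ℝ, klBetaMin ≤ β → β ≤ Real.exp (c / U ^ 2) →
            ∀ (K : TrigPolyC4v) (Lstar : ℕ) (Mstar : ℕ → ℕ), TowerP klPredsV17F2 G P Q R β U μ K Lstar Mstar →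
            ∃ (sE cR cC δ : ℕ → ℕ → ℝ),
              (∀ j L, 0 ≤ sE j L ∧ 0 ≤ cR j L ∧ 0 ≤ cC j L ∧ 0 ≤ δ j L ∧ cR j L ≤ 1 ∧ cC j L ≤ 1 ∧ δ j L ≤ 1) ∧
              (∀ j, Tendsto (sE j) atTop (𝓝 0) ∧ Tendsto (cR j) atTop (𝓝 0) ∧ Tendsto (cC j) atTop (𝓝 0) ∧ Tendsto (δ j) atTop (𝓝 0)) ∧
            ∃ L₂ : ℕ, ∃ M₂ : ℕ → ℕ → ℕ, ∀ (L b M : ℕ) [NeZero L] [NeZero (b * L)] [NeZero M], L₂ ≤ L → M₂ L b ≤ M →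
              (∀ j, j < nScales β → ∀ x y, ‖(klStepCov (b * L) M β μ (klFlowFrameU (b * L) M β U μ (nScales β + 1)) j - klStepCov (b * L) M β μ (klFlowFrameU L M β U μ (nScales β + 1)) j) x y‖ ≤ sE j L) ∧
              (∀ j, j < nScales β → ∀ x, ∑ y, ‖(klStepCov (b * L) M β μ (klFlowFrameU (b * L) M β U μ (nScales β + 1)) j - klStepCov (b * L) M β μ (klFlowFrameU L M β U μ (nScales β + 1)) j) x y‖ ≤
                cR j L / imagTimeWeight β M) ∧
              (∀ j, j < nScales β → ∀ y, ∑ x, ‖(klStepCov (b * L) M β μ (klFlowFrameU (b * L) M β U μ (nScales β + 1)) j - klStepCov (b * L) M β μ (klFlowFrameU L M β U μ (nScales β + 1)) j) x y‖ ≤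
                cC j L / imagTimeWeight β M) ∧
              (∀ j, j ≤ nScales β → ∀ x, ∑ y, ‖klTowerTransfer (b * L) M β μ (klFlowFrameU (b * L) M β U μ (nScales β + 1)) j x y - klTowerTransfer (b * L) M β μ (klFlowFrameU L M β U μ (nScales β + 1)) j x y‖ ≤ δ j L) ∧
              (∀ j, j ≤ nScales β → ∀ y, ∑ x, ‖klTowerTransfer (b * L) M β μ (klFlowFrameU (b * L) M β U μ (nScales β + 1)) j x y - klTowerTransfer (b * L) M β μ (klFlowFrameU L M β U μ (nScales β + 1)) j x y‖ ≤ δ j L))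
    (HB1W : ∀ (G : GeoConsts) (P : SplitConsts) (Q : EngConsts) (R : RenConsts), G.WF → P.WF → Q.WF → R.WF2 →
        ∃ c₇ : ℝ, 0 < c₇ ∧ ∀ c : ℝ, 0 < c → c ≤ c₇ → ∃ U₇ : ℝ, 0 < U₇ ∧
          ∀ μ ∈ klWindowC, ∀ U : ℝ, 0 < U → U ≤ U₇ → ∀ β : ℝ, klBetaMin ≤ β → β ≤ Real.exp (c / U ^ 2) →
            ∀ (K : TrigPolyC4v) (Lstar : ℕ) (Mstar : ℕ → ℕ), TowerP klPredsV17F2 G P Q R β U μ K Lstar Mstar →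
            ∃ M₂ : ℕ → ℕ → ℕ, ∀ (k : ℕ) (η : ℝ), 0 < η → ∃ L₂ : ℕ, ∀ (L b M : ℕ) [NeZero L] [NeZero (b * L)] [NeZero M], L₂ ≤ L → M₂ L b ≤ M →
              ∀ (p : Fin k) (w : SrcLabel (b * L) M 0),
                (∀ i, 2 * (L / (4 * nScales β + 7)) ≤ (w.1.1.2 i).val % L ∧ (w.1.1.2 i).val % L + 2 * (L / (4 * nScales β + 7)) < L) →
                klKeyedDefectTSW L b M β U μ (klFlowFrameU L M β U μ (nScales β + 1)) (klFlowFrameU (b * L) M β U μ (nScales β + 1)) 1 0 k p w ≤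
                  imagTimeWeight β M * η)
    (hSrc : ∀ (P : SplitConsts) (R : RenConsts), P.WF → R.WF2 →
      ∃ Q' : EngConsts, 0 ≤ Q'.CE ∧ ∃ c₀ : ℝ, 0 < c₀ ∧ ∀ c : ℝ, 0 < c → c ≤ c₀ → ∃ U₀ : ℝ, 0 < U₀ ∧
        ∀ μ ∈ klWindowC, ∀ U : ℝ, 0 < U → U ≤ U₀ → ∀ β : ℝ, klBetaMin ≤ β → β ≤ Real.exp (c / U ^ 2) →
          ∃ A : ℕ → ℕ → ℝ, ∃ L₁ : ℕ, ∃ M₁ : ℕ → ℕ, ∀ (L M : ℕ) [NeZero L] [NeZero M], L₁ ≤ L → M₁ L ≤ M →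
            ∀ j : ℕ, j + 1 ≤ nScales β + 1 →
              SourceProfilesAtLev L M (klSrcBudget P Q' U A (j + 1)) β U μ (klFlowFrameU L M β U μ (nScales β + 1)) j j (j + 1))
    (G : GeoConsts) (P : SplitConsts) (Q : EngConsts) (R : RenConsts) (hG : G.WF) (hP : P.WF) (hQ : Q.WF) (hR2 : R.WF2) :
    ∃ c₅ : ℝ, 0 < c₅ ∧ ∀ c : ℝ, 0 < c → c ≤ c₅ → ∃ U₀ : ℝ, 0 < U₀ ∧
      ∀ μ ∈ klWindowC, ∀ U : ℝ, 0 < U → U ≤ U₀ → ∀ β : ℝ, klBetaMin ≤ β → β ≤ Real.exp (c / U ^ 2) →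
        ∀ K : TrigPolyC4v, klPredsV17F2.frameOK R U (nScales β) μ K →
          ∀ (Lstar : ℕ) (Mstar : ℕ → ℕ), TowerP klPredsV17F2 G P Q R β U μ K Lstar Mstar →
            ∃ t : ℝ, 0 < t ∧ t ≤ 1 ∧ Nonempty (TowerDataTSW β U μ t) := by
  -- the producer text at `(P, R₁)`
  have hR₁ : (⟨1, 1, fun _ => 1⟩ : RenConsts).WF2 := ⟨⟨zero_le_one, zero_le_one, fun _ => zero_le_one⟩, one_pos, one_pos⟩
  obtain ⟨Q', hQ'CE, c₀, hc₀, hS⟩ := hSrc P ⟨1, 1, fun _ => 1⟩ hP hR₁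
  have hKl : 0 < P.Klam := lt_of_lt_of_le one_pos hP.1
  have hKl0 : 0 ≤ P.Klam := hKl.le
  -- the body of `hSup` at `(G, P, Q, R, Q')` from the atoms, and the `ε`-doors
  obtain ⟨k₀, B₂, B₃, W, hk₀, hB₂, hB₃, hW, c₆, hc₆, hsup⟩ := hSupRegBody_of_atomsBW Hcov HE1 Hmis HB1W G P Q R Q' hG hP hQ hR2 hQ'CE
  obtain ⟨c₅, hc₅, U₅, hU₅, hdoors⟩ := exists_doors_towerEps hKl hB₂ hB₃ hW hk₀
  refine ⟨min (min c₅ c₀) c₆, lt_min (lt_min hc₅ hc₀) hc₆, fun c hc0 hcc => ?_⟩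
  have hcc₅ : c ≤ c₅ := hcc.trans ((min_le_left _ _).trans (min_le_left _ _))
  have hcc₀ : c ≤ c₀ := hcc.trans ((min_le_left _ _).trans (min_le_right _ _))
  have hcc₆ : c ≤ c₆ := hcc.trans (min_le_right _ _)
  obtain ⟨U₀, hU₀, hS2⟩ := hS c hc0 hcc₀
  obtain ⟨U₆, hU₆, hsup2⟩ := hsup c hc0 hcc₆
  refine ⟨min (min U₅ U₀) U₆, lt_min (lt_min hU₅ hU₀) hU₆, fun μ hμ U hU0 hUU β hβmin hβmax K hK Lstar Mstar hT => ?_⟩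
  have hUU₅ : U ≤ U₅ := hUU.trans ((min_le_left _ _).trans (min_le_left _ _))
  have hUU₀ : U ≤ U₀ := hUU.trans ((min_le_left _ _).trans (min_le_right _ _))
  have hUU₆ : U ≤ U₆ := hUU.trans (min_le_right _ _)
  obtain ⟨A, L₁, M₁, hA⟩ := hS2 μ hμ U hU0 hUU₀ β hβmin hβmax
  have hUabs : |U| ≤ U₅ := by rw [abs_of_pos hU0]; exact hUU₅
  refine hsup2 μ hμ U hU0 hUU₆ β hβmin hβmax K hK Lstar Mstar hT (fun j hj => hdoors c hc0.le hcc₅ U hU0.ne' hUabs β hβmin hβmax j hj)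
    (fun j s => max (A j s) 0) L₁ M₁ (fun j s => le_max_right _ _) ?_
  intro L M _ _ hL hM j hj
  exact (hA L M hL hM j hj).mono fun s m => klSrcBudget_mono_A P Q' U hQ'CE hKl0 (fun j s => le_max_left _ _) (j + 1) s m

end Summit.HubbardSuperconductivity.HubbardSuperconductivity.Theorems.TwoVolumeSource

end
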